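import Mathlib
import Summits.Schanuel.Schanuel.Theses.RigidCore
import Summits.Schanuel.Schanuel.Theses.GaussianStokesSector
import Summits.Schanuel.Schanuel.Theorems.RigidCoreSchanuelOnLogFreeCoreSectorGlue
import Summits.Schanuel.Schanuel.Theorems.RigidCoreSchanuelOnLogFreeCoreSectorExact
import Summits.Schanuel.Schanuel.Theorems.RigidCoreSchanuelOnLogFreeCoreCoreRelOfRelSchanuel
import Summits.Schanuel.Schanuel.Theorems.RigidCoreSchanuelOnLogFreeCorePiFreeOfStageZero
import Summits.Schanuel.Schanuel.Theorems.RigidCoreSchanuelOnLogFreeCoreSandwich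

/-!
# Line `sector-split` (route `RigidCore`): the exact sector split of (R), by name

Packaging file of line `sector-split` of crux `stmt-Schanuel-0970`
(`Summit.Schanuel.Schanuel.Theses.RigidCore.SchanuelOnLogFreeCore`, (R) = Schanuel's statement for
`ℚ`-linearly independent tuples from the log-free core `C_EA`).  Registered stub
`stub_sectorSplitExact` (signature verbatim): the crux-strategist's split (S)
(`Cruxes/SchanuelOnLogFreeCore/STRATEGY-CENSUS.md` §4) is EXACT,

  `(R) ⟺ PiFreeOverLWField ∧ CoreRel`,

where `PiFreeOverLWField` is route GaussianStokesSector's crux (ledger item stmt-Schanuel-9545, shared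
verbatim with ExceptionalSubspaces / SingularModulusScaling: `π` is transcendental over the
Lindemann–Weierstrass field) and `CoreRel` is relative Schanuel over the π–LW field
`K₂ = ℚ(ℚ̄ ∪ {πi} ∪ e^{ℚ̄})` for CORE tuples free modulo `V₂ = span_ℚ(ℚ̄ ∪ {πi})` (item
stmt-Schanuel-9548 `RelSchanuelOverPiLWField` restricted to core tuples).  All three arrows are
landed theorems of the line, assembled here by name:
* `⟹ PiFreeOverLWField`: `KernelTower.piFreeOverLWField_of_schanuelOnLogFreeCore` (p109943);
* `⟹ CoreRel`: `stub_coreRel_of_crux` (`…SectorExact`, hull count);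
* `⟸`: `stub_sectorGlue` (`…SectorGlue`, Kirby's `GL_n(ℚ)` sector bookkeeping on core tuples).
Corollaries: the crux follows from the two EXISTING ledger items stmt-Schanuel-9545 and
stmt-Schanuel-9548 (`SectorSplit.crux_of_piFree_of_relSchanuel`), and the full calibration chain
`Schanuel ⟹ (9545 ∧ 9548) ⟹ (R) ⟹ 9545 ⟹ e ⊥ π` (`SectorSplit.calibration`).
No new definitions; the open statements appear only as hypotheses / conjuncts.
-/

noncomputable section

namespace Summit.Schanuel.Schanuel.Theorems.RigidCore

open Summit.Schanuel.Schanuel.Theses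

/-- **Registered stub `stub_sectorSplitExact` of line `sector-split`** (signature verbatim): the
sector split of (R) along `V₂ = span_ℚ(ℚ̄ ∪ {πi})` is exact —
`(R) ⟺ PiFreeOverLWField ∧ CoreRel`. [folklore] -/
theorem stub_sectorSplitExact :
    RigidCore.SchanuelOnLogFreeCore ↔
      (GaussianStokesSector.PiFreeOverLWField ∧
        ∀ (n : ℕ) (x : Fin n → ℂ),
          (∀ i, x i ∈ (sInf {K : IntermediateField ℚ ℂ | (2 * ↑Real.pi * Complex.I : ℂ) ∈ K ∧
            (∀ w ∈ K, Complex.exp w ∈ K) ∧ ∀ w : ℂ, IsAlgebraic K w → w ∈ K} : IntermediateField ℚ ℂ)) →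
          LinearIndependent ℚ ((Submodule.span ℚ ({z : ℂ | IsAlgebraic ℚ z} ∪ {(Real.pi : ℂ) * Complex.I})).mkQ ∘ x) →
          (n : Cardinal) ≤ Algebra.trdeg
            ↥(IntermediateField.adjoin ℚ ({z : ℂ | IsAlgebraic ℚ z} ∪ {(Real.pi : ℂ) * Complex.I} ∪ Complex.exp '' {z : ℂ | IsAlgebraic ℚ z}))
            ↥(IntermediateField.adjoin ↥(IntermediateField.adjoin ℚ ({z : ℂ | IsAlgebraic ℚ z} ∪ {(Real.pi : ℂ) * Complex.I} ∪ Complex.exp '' {z : ℂ | IsAlgebraic ℚ z})) (Set.range x ∪ Set.range (Complex.exp ∘ x)))) :=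
  ⟨fun hR => ⟨KernelTower.piFreeOverLWField_of_schanuelOnLogFreeCore hR, stub_coreRel_of_crux hR⟩,
    fun h => stub_sectorGlue h.1 h.2⟩

namespace SectorSplit

/-- **The crux from the two existing ledger items**: `PiFreeOverLWField` (stmt-Schanuel-9545) and
`RelSchanuelOverPiLWField` (stmt-Schanuel-9548) imply (R) — the landed glue composed with
`stub_coreRel_of_relSchanuel`. (Conditional: both hypotheses are OPEN.) [folklore] -/
theorem crux_of_piFree_of_relSchanuel (hP : GaussianStokesSector.PiFreeOverLWField)
    (hRel : GaussianStokesSector.RelSchanuelOverPiLWField) : RigidCore.SchanuelOnLogFreeCore :=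
  stub_sectorGlue hP (stub_coreRel_of_relSchanuel hRel)

/-- **Calibration chain of the line, by name**:
`Schanuel ⟹ (PiFreeOverLWField ∧ RelSchanuelOverPiLWField)`-free form — Schanuel ⟹ (R)
(`Sandwich.crux_of_schanuelConjecture`), (R) ⟹ `PiFreeOverLWField` (p109943), and
`PiFreeOverLWField ⟹ ExpOnePiAlgebraicIndependent` (`e ⊥ π`, printed OPEN;
`KernelTower.expOnePi_of_piFreeOverLWField`). [folklore] -/
theorem calibration :
    (Schanuel → RigidCore.SchanuelOnLogFreeCore) ∧
      (RigidCore.SchanuelOnLogFreeCore → GaussianStokesSector.PiFreeOverLWField) ∧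
      (GaussianStokesSector.PiFreeOverLWField →
        Literature.NumberTheory.Transcendental.ExpOnePiAlgebraicIndependent) :=
  ⟨fun h => Sandwich.crux_of_schanuelConjecture h,
    KernelTower.piFreeOverLWField_of_schanuelOnLogFreeCore,
    KernelTower.expOnePi_of_piFreeOverLWField⟩

end SectorSplit

end Summit.Schanuel.Schanuel.Theorems.RigidCore

end
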